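import Summits.FinalStateConjecture.FinalStateConjecture.Theorems.EIHFluxBalanceInertialRecessionStubSlaving12JetCalculus
import Summits.FinalStateConjecture.FinalStateConjecture.Theorems.EIHFluxBalanceInertialRecessionStubSlaving12JetCompact
import Summits.FinalStateConjecture.FinalStateConjecture.Theorems.EIHFluxBalanceInertialRecessionStubSlaving12JetCompare
import Summits.FinalStateConjecture.FinalStateConjecture.Theorems.EIHFluxBalanceInertialRecessionStubSlaving12Reduction
import Summits.FinalStateConjecture.FinalStateConjecture.Theorems.EIHFluxBalanceInertialRecessionAnsatzSmooth

/-!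
# Route EIHFluxBalance — `InertialRecession` (E′), line `SketchCleanExcision`:
# the frozen ansatz is asymptotically Ricci-flat RELATIVE TO ITS OWN 3-JET near every hole
# (`C²` and `C³`, from frozen-vacuum data alone; file …StubSlaving12RelRicciC3), and the reduction of `stub_slaving` to
# RELATIVE-RICCI SLAVING — a statement about the explicit ansatz `g₀` only

Helper file for the crux `stmt-FinalStateConjecture-17403`
(`Summit.FinalStateConjecture.FinalStateConjecture.Theses.EIHFluxBalance.InertialRecession`, E′),
stub `stub_slaving`. `…StubSlaving12Reduction` reduced the stub to FROZEN-VACUUM SLAVING (an `e`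
with (V) `Ric(e + g₀) = 0` on late hole-following tubes and (S) `C³`-smallness of `e`). This file
consumes `e` completely:

* `exists_relRicci_of_frozenVacuum` — **capstone (`C²` and `C³`, jet-relative)**: under (V), (S)
  and three kinematic clauses (Lorentz factors `≤ γ`, smooth motions, separating centres), for
  every hole `i`, lab radius `R`, floor `r₀ ≥ rinᵢ` and `ε > 0` there is `T` such that at every
  point `x` of the tube `{x⁰ > T, ‖x̲ − ξᵢ(x⁰)‖ < R, rᵢ > r₀}` and every `λ ≥ 1` with
  `‖Dg₀(x)‖ ≤ λ`, `‖D²g₀(x)‖ ≤ λ²`: `‖Ric(g₀)(x)‖ ≤ ε λ²`, and if moreover `‖D³g₀(x)‖ ≤ λ³` then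
  `‖D[Ric g₀](x)‖ ≤ ε λ³`. Proof: ZOOM by `ψ(w) = x + w/λ` (`…StubSlaving12JetCalculus`): the zoomed
  lab field `(e + g₀) ∘ ψ` is Ricci-flat near `0`, the zoomed ansatz `g₀ ∘ ψ` has
  `Ric = λ⁻² Ric(g₀)(x)`, `D Ric = λ⁻³ D[Ric g₀](x)` at `0`, its `2`-jet lies in the compact set
  `{0} × {‖A‖ ≤ α, (m/4)-coercive} × B̄(0,1)²` (late-time coercivity and boundedness of the ansatz,
  `…StubSlaving12JetCompact`, `…StubSlaving11AnsatzBound`) inside the open domain of the Ricci jet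
  function, where `ricciJet` and `D ricciJet` are uniformly Lipschitz and bounded
  (`exists_uniform_lipschitz_near_isCompact`), and the two zoomed jets differ by the zoomed jets
  of `e`, of size `≤ δ` by (S); the comparison itself is `norm_ricAt_le_of_jets` /
  `norm_fderiv_ricAt_le_of_jets` (`…StubSlaving12JetCompare`; chain rule
  `D[Ric G](0) = D ricciJet(j₂G) ∘ Dj₂G` for the third order).
* `frozenVacuumSlaving_of_relRicciSlaving`, `stub_slaving_of_relRicciSlaving` — **reduction**:
  RELATIVE-RICCI SLAVING (for all painted moduli as in the crux and the explicit ansatz `g₀`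
  alone: jet-relative `C²`/`C³` Ricci-smallness on late hole-following tubes ⇒ `SLAVED³`) implies
  FROZEN-VACUUM SLAVING, hence the registered statement of `stub_slaving` verbatim
  (`stub_slaving_of_frozenVacuumSlaving`). What RELATIVE-RICCI SLAVING still contains is the
  algebra of ONE painted summand (the jet ↦ Ricci map: zero set F1 `…StubSlaving3ZeroSet`,
  coercivity NLCOER `…StubSlaving11JetAbsorb`, verified in exact arithmetic only) plus the
  far-field decoupling (`…StubSlaving3FarField`, `a = 0`).

No definitions, no named facts, no `sorry`.
-/

set_option linter.dupNamespace false
set_option maxSynthPendingDepth 6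
set_option synthInstance.maxHeartbeats 200000

noncomputable section

namespace Summit.FinalStateConjecture.FinalStateConjecture.Theorems.SublinearIsFree.Slaving

open scoped BigOperators Topology Manifold ContDiff ENNReal
open Filter Set Function TopologicalSpace Metric Literature.Geometry.Lorentzian
  Literature.Geometry.Lorentzian.MetricCoord
open Summit.FinalStateConjecture.FinalStateConjecture.Theorems

/-- The space of `2`-jets of metric components on `E4` (local notation). -/
local notation "Jet" => E4 × (E4 →L[ℝ] E4 →L[ℝ] ℝ) × (E4 →L[ℝ] E4 →L[ℝ] E4 →L[ℝ] ℝ) ×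
  (E4 →L[ℝ] E4 →L[ℝ] E4 →L[ℝ] E4 →L[ℝ] ℝ)

/-! ### The capstone: jet-relative `C²`/`C³` Ricci-smallness of the frozen ansatz -/

set_option maxHeartbeats 8000000 in
/-- **The frozen ansatz is asymptotically Ricci-flat relative to its own `3`-jet near every hole,
from frozen-vacuum data.** Painted moduli with Lorentz factors `≤ γ`, smooth motions, separating
centres, subextremal parameters with `r₋ < rinᵢ < r₊`; a field `e` with (V) `e + g₀` vacuum metric
components on every late hole-following tube with floor `≥ rinᵢ` (avoiding all cores) and (S)
`C³`-small on the core-free late slabs. Then for every hole `i`, `R`, `r₀ ≥ rinᵢ`, `ε > 0` there is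
`T` with: at every `x` of the tube `{x⁰ > T, ‖x̲ − ξᵢ(x⁰)‖ < R, rᵢ > r₀}` and every `λ ≥ 1` with
`‖Dg₀(x)‖ ≤ λ`, `‖D²g₀(x)‖ ≤ λ²`: `‖Ric(g₀)(x)‖ ≤ ε λ²`, and `‖D³g₀(x)‖ ≤ λ³ ⇒ ‖D[Ric g₀](x)‖ ≤ ε λ³`
(zoom by `1/λ`, compactness of the zoomed ansatz jets, Lipschitz bounds for `ricciJet` and its
derivative, vacuum of the zoomed lab field). [folklore] -/
theorem exists_relRicci_of_frozenVacuum {N : ℕ} {M a rin : Fin N → ℝ} {Λ : Fin N → ℝ → lorentzGroup}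
    {ξ : Fin N → ℝ → E3} {γ : ℝ} {e : E4 → E4 →L[ℝ] E4 →L[ℝ] ℝ}
    (h1 : (∀ i, Kerr.IsSubextremal (M i) (a i) ∧ Kerr.rMinus (M i) (a i) < rin i ∧ rin i < Kerr.rPlus (M i) (a i)))
    (hγ : (∀ i t, |((Λ i t : E4 ≃L[ℝ] E4) (E4.basisVector 0)) 0| ≤ γ))
    (hsm : (∀ i, ContDiff ℝ ((⊤ : ℕ∞) : WithTop ℕ∞) (ξ i) ∧ ContDiff ℝ ((⊤ : ℕ∞) : WithTop ℕ∞) (fun t ↦ ((Λ i t : E4 ≃L[ℝ] E4) : E4 →L[ℝ] E4))))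
    (hsep : (∀ i j, i ≠ j → Tendsto (fun t ↦ ‖ξ i t - ξ j t‖) atTop atTop))
    (hV : (∀ (i : Fin N) (R r₀ : ℝ), rin i ≤ r₀ → ∃ T : ℝ, MetricCoord.IsMetricOn (fun z : E4 ↦ e z + (Minkowski.bilin + ∑ i, (boostedKerrBilin (Λ i (z 0)) (E4.ofTimeSpace (z 0) (ξ i (z 0))) (M i) (a i) z - Minkowski.bilin))) {x : E4 | T < x 0 ∧ ‖E4.spatial x - ξ i (x 0)‖ < R ∧ r₀ < Kerr.radius (a i) (poincareInv (Λ i (x 0)) (E4.ofTimeSpace (x 0) (ξ i (x 0))) x)} ∧ ∀ x : E4, T < x 0 → ‖E4.spatial x - ξ i (x 0)‖ < R → r₀ < Kerr.radius (a i) (poincareInv (Λ i (x 0)) (E4.ofTimeSpace (x 0) (ξ i (x 0))) x) → (∀ j, rin j < Kerr.radius (a j) (poincareInv (Λ j (x 0)) (E4.ofTimeSpace (x 0) (ξ j (x 0))) x)) ∧ MetricCoord.ricAt (fun z : E4 ↦ e z + (Minkowski.bilin + ∑ i, (boostedKerrBilin (Λ i (z 0)) (E4.ofTimeSpace (z 0)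 (ξ i (z 0))) (M i) (a i) z - Minkowski.bilin))) x = 0))
    (hS : Tendsto (fun t : ℝ ↦ supCkENorm {x : E4 | x 0 = t ∧ ∀ j, rin j < Kerr.radius (a j) (poincareInv (Λ j (x 0)) (E4.ofTimeSpace (x 0) (ξ j (x 0))) x)} 3 e) atTop (𝓝 0))
    (i : Fin N) (R r₀ : ℝ) (hr₀ : rin i ≤ r₀) {ε : ℝ} (hε : 0 < ε) :
    ∃ T : ℝ, ∀ x : E4, T < x 0 → ‖E4.spatial x - ξ i (x 0)‖ < R → r₀ < Kerr.radius (a i) (poincareInv (Λ i (x 0)) (E4.ofTimeSpace (x 0) (ξ i (x 0))) x) → ∀ l : ℝ, 1 ≤ l → ‖fderiv ℝ (fun z : E4 ↦ Minkowski.bilin + ∑ i, (boostedKerrBilin (Λ i (z 0)) (E4.ofTimeSpace (z 0) (ξ i (z 0))) (M i) (a i) z - Minkowski.bilin)) x‖ ≤ l → ‖fderiv ℝ (fderiv ℝ (fun z : E4 ↦ Minkowski.bilin + ∑ i, (boostedKerrBilin (Λ i (z 0)) (E4.ofTimeSpace (z 0) (ξ i (z 0))) (M i) (a i) z - Minkowski.bilin)))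 x‖ ≤ l ^ 2 → ‖MetricCoord.ricAt (fun z : E4 ↦ Minkowski.bilin + ∑ i, (boostedKerrBilin (Λ i (z 0)) (E4.ofTimeSpace (z 0) (ξ i (z 0))) (M i) (a i) z - Minkowski.bilin)) x‖ ≤ ε * l ^ 2 ∧ (‖fderiv ℝ (fderiv ℝ (fderiv ℝ (fun z : E4 ↦ Minkowski.bilin + ∑ i, (boostedKerrBilin (Λ i (z 0)) (E4.ofTimeSpace (z 0) (ξ i (z 0))) (M i) (a i) z - Minkowski.bilin)))) x‖ ≤ l ^ 3 → ‖fderiv ℝ (MetricCoord.ricAt (fun z : E4 ↦ Minkowski.bilin + ∑ i, (boostedKerrBilin (Λ i (z 0)) (E4.ofTimeSpace (z 0) (ξ i (z 0))) (M i) (a i) z - Minkowski.bilin))) x‖ ≤ ε * l ^ 3) := by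
  set g₀ : E4 → E4 →L[ℝ] E4 →L[ℝ] ℝ := (fun z : E4 ↦ Minkowski.bilin + ∑ i, (boostedKerrBilin (Λ i (z 0)) (E4.ofTimeSpace (z 0) (ξ i (z 0))) (M i) (a i) z - Minkowski.bilin)) with hg₀
  -- sizes
  have hr₀' : 0 < r₀ := ((h1 i).1.rMinus_nonneg.trans_lt (h1 i).2.1).trans_le hr₀
  have hγ1 : 1 ≤ γ := (one_le_abs_lorentz_apply_zero (Λ i 0)).trans (hγ i 0)
  have hK₀ : 0 < (1 + 3 * γ) ^ 2 * (1 + 4 * (|M i| / r₀)) :=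
    mul_pos (pow_pos (by linarith) 2) (by positivity)
  set m : ℝ := ((1 + 3 * γ) ^ 2 * (1 + 4 * (|M i| / r₀)))⁻¹ with hm
  have hm0 : 0 < m := inv_pos.2 hK₀
  set α : ℝ := ‖(Minkowski.bilin : E4 →L[ℝ] E4 →L[ℝ] ℝ)‖ +
    ∑ j, 4 * (|M j| / min r₀ 1) * (1 + 3 * γ) ^ 2 with hα
  -- the compact jet box inside the domain of the Ricci jet function
  set KA : Set (E4 →L[ℝ] E4 →L[ℝ] ℝ) := {A | ‖A‖ ≤ α ∧ ∀ v : E4, m / 4 * ‖v‖ ≤ ‖A v‖} with hKA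
  set Kj : Set Jet := ({(0 : E4)} : Set E4) ×ˢ (KA ×ˢ
    (closedBall (0 : E4 →L[ℝ] E4 →L[ℝ] E4 →L[ℝ] ℝ) 1 ×ˢ
      closedBall (0 : E4 →L[ℝ] E4 →L[ℝ] E4 →L[ℝ] E4 →L[ℝ] ℝ) 1)) with hKj
  have hKjc : IsCompact Kj :=
    isCompact_singleton.prod ((isCompact_coerciveBox α (m / 4)).prod
      ((isCompact_closedBall _ _).prod (isCompact_closedBall _ _)))
  have hΩ := isOpen_ricciJetDomain (E := E4)
  haveI i1 : FiniteDimensional ℝ (E4 →L[ℝ] E4 →L[ℝ] ℝ) := inferInstance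
  haveI i2 : FiniteDimensional ℝ (E4 →L[ℝ] E4 →L[ℝ] E4 →L[ℝ] ℝ) := inferInstance
  haveI i3 : FiniteDimensional ℝ (E4 →L[ℝ] E4 →L[ℝ] E4 →L[ℝ] E4 →L[ℝ] ℝ) := inferInstance
  haveI i4 : FiniteDimensional ℝ Jet := inferInstance
  haveI : ProperSpace Jet := FiniteDimensional.proper_real _
  have hKjΩ : Kj ⊆ {j : Jet | j.2.1.IsInvertible} :=
    fun j hj ↦ coerciveBox_subset_isInvertible (by positivity) hj.2.1
  -- uniform Lipschitz data for `ricciJet` and its derivative near the box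
  have hR1 : ContDiffOn ℝ 1 (ricciJet (E := E4)) {j : Jet | j.2.1.IsInvertible} :=
    contDiffOn_ricciJet.of_le (by simp)
  have hR2 : ContDiffOn ℝ 1 (fderiv ℝ (ricciJet (E := E4))) {j : Jet | j.2.1.IsInvertible} :=
    (contDiffOn_ricciJet.fderiv_of_isOpen hΩ (m := ∞) (by simp)).of_le (by simp)
  obtain ⟨r₁, hr₁, L₀, B₀, hL₀, -, hLip₀⟩ := exists_uniform_lipschitz_near_isCompact hΩ hR1 hKjc hKjΩ
  obtain ⟨r₂, hr₂, L₁, B₁, hL₁, hB₁, hLip₁⟩ := exists_uniform_lipschitz_near_isCompact hΩ hR2 hKjc hKjΩ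
  -- the smallness threshold
  have hS0 : 0 < L₀ + L₁ + B₁ + 1 := by linarith
  set δ : ℝ := min (min r₁ r₂) (ε / (L₀ + L₁ + B₁ + 1)) with hδ
  have hδ0 : 0 < δ := lt_min (lt_min hr₁ hr₂) (div_pos hε hS0)
  have hδr₁ : δ ≤ r₁ := (min_le_left _ _).trans (min_le_left _ _)
  have hδr₂ : δ ≤ r₂ := (min_le_left _ _).trans (min_le_right _ _)
  have hδε : (L₀ + L₁ + B₁ + 1) * δ ≤ ε := by
    have : δ ≤ ε / (L₀ + L₁ + B₁ + 1) := min_le_right _ _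
    rwa [le_div_iff₀ hS0, mul_comm] at this
  -- late times
  obtain ⟨T₁, hG₁, hvac⟩ := hV i R r₀ hr₀
  have E1 := eventually_ansatz_coercive_near_hole (M := M) (a := a) hγ hsep i R hr₀'
  have E2 := eventually_norm_ansatz_le_near_hole (M := M) (a := a) hγ hsep i R hr₀'
  have E3 : ∀ᶠ t in atTop, supCkENorm {x : E4 | x 0 = t ∧ ∀ j, rin j < Kerr.radius (a j) (poincareInv (Λ j (x 0)) (E4.ofTimeSpace (x 0) (ξ j (x 0))) x)} 3 e < ENNReal.ofReal δ :=
    (tendsto_order.1 hS).2 _ (ENNReal.ofReal_pos.2 hδ0)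
  obtain ⟨T₂, hT₂⟩ := eventually_atTop.1 ((E1.and E2).and E3)
  refine ⟨max T₁ T₂, fun x hxT hxR hxr l hl hD1 hD2 ↦ ?_⟩
  have hxT₁ : T₁ < x 0 := (le_max_left _ _).trans_lt hxT
  have hxT₂ : T₂ < x 0 := (le_max_right _ _).trans_lt hxT
  -- the open neighbourhood `A` of `x`
  set A : Set E4 := {z : E4 | T₁ < z 0 ∧ ‖E4.spatial z - ξ i (z 0)‖ < R ∧ r₀ < Kerr.radius (a i) (poincareInv (Λ i (z 0)) (E4.ofTimeSpace (z 0) (ξ i (z 0))) z)} ∩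
    {z : E4 | T₂ < z 0} with hA
  have hAo : IsOpen A :=
    hG₁.isOpen.inter (isOpen_lt continuous_const (EuclideanSpace.proj (0 : Fin 4)).continuous)
  have hxA : x ∈ A := ⟨⟨hxT₁, hxR, hxr⟩, hxT₂⟩
  have hfacts : ∀ z ∈ A, (∀ j, 0 < Kerr.radius (a j) (poincareInv (Λ j (z 0)) (E4.ofTimeSpace (z 0) (ξ j (z 0))) z)) ∧ (∀ v : E4, m / 2 * ‖v‖ ≤ ‖g₀ z v‖) ∧ ‖g₀ z‖ ≤ α ∧
      (∀ j, rin j < Kerr.radius (a j) (poincareInv (Λ j (z 0)) (E4.ofTimeSpace (z 0) (ξ j (z 0))) z)) ∧ ricAt (fun w ↦ e w + g₀ w) z = 0 := by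
    intro z hz
    obtain ⟨⟨hzT₁, hzR, hzr⟩, hzT₂⟩ := hz
    obtain ⟨⟨h1', h2'⟩, -⟩ := hT₂ (z 0) hzT₂.le
    obtain ⟨hr, hc⟩ := h1' z rfl hzR.le hzr.le
    obtain ⟨hcore, hric⟩ := hvac z hzT₁ hzR hzr
    exact ⟨hr, hc, h2' z rfl hzR.le hzr.le, hcore, hric⟩
  -- metric components on `A`
  have hG : IsMetricOn (fun w ↦ e w + g₀ w) A :=
    ⟨hAo, hG₁.contDiffOn.mono inter_subset_left, fun z hz v w ↦ hG₁.symm z hz.1 v w,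
      fun z hz ↦ hG₁.isInvertible z hz.1⟩
  have hG' : IsMetricOn g₀ A := by
    refine ⟨hAo, fun z hz ↦ ?_, fun z _ v w ↦ ?_, fun z hz ↦ ?_⟩
    · exact (contDiffAt_ansatzBilin' N M a Λ ξ (fun j ↦ (hsm j).2) (fun j ↦ (hsm j).1) z
        (hfacts z hz).1).contDiffWithinAt
    · show (Minkowski.bilin + ∑ i, (boostedKerrBilin (Λ i (z 0)) (E4.ofTimeSpace (z 0) (ξ i (z 0)))
        (M i) (a i) z - Minkowski.bilin)) v w = (Minkowski.bilin + ∑ i, (boostedKerrBilin (Λ i (z 0))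
        (E4.ofTimeSpace (z 0) (ξ i (z 0))) (M i) (a i) z - Minkowski.bilin)) w v
      simp only [add_apply, FunLike.coe_sum, Finset.sum_apply,
        sub_apply, Minkowski.bilin_symm v w, boostedKerrBilin_symm _ _ _ _ z v w]
    · refine MetricCoord.isInvertible_of_nondegenerate fun v hv ↦ ?_
      have h0 : g₀ z v = 0 := ContinuousLinearMap.ext fun w ↦ hv w
      have h1' := (hfacts z hz).2.1 v
      rw [h0, norm_zero] at h1'
      have h2 : ‖v‖ ≤ 0 := by nlinarith [norm_nonneg v]
      exact norm_le_zero_iff.1 h2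
  have he : ContDiffOn ℝ ∞ e A := by
    have hex : e = fun z ↦ (e z + g₀ z) - g₀ z := funext fun z ↦ (add_sub_cancel_right _ _).symm
    rw [hex]
    exact hG.contDiffOn.sub hG'.contDiffOn
  -- from here on the ansatz is only used through `hG'`, `hfacts`: forget its definition
  clear_value g₀
  -- jets of the sum `e + g₀` at `x`, up to order three (generic lemma, instantiated here)
  have hS := fderiv_add_jets he hG'.contDiffOn hAo hxA
  -- facts at `x`
  obtain ⟨-, hxc, hxα, hxcore, -⟩ := hfacts x hxA
  obtain ⟨-, hE3x⟩ := hT₂ (x 0) hxT₂.le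
  have hmem : x ∈ {y : E4 | y 0 = x 0 ∧ ∀ j, rin j < Kerr.radius (a j) (poincareInv (Λ j (y 0)) (E4.ofTimeSpace (y 0) (ξ j (y 0))) y)} := ⟨rfl, hxcore⟩
  have hdevk : ∀ k ≤ 3, ‖iteratedFDeriv ℝ k e x‖ ≤ δ := by
    intro k hk
    have h1' := enorm_iteratedFDeriv_le_supCkENorm hk hmem e
    rw [← ofReal_norm] at h1'
    exact ((ENNReal.ofReal_lt_ofReal_iff hδ0).1 (h1'.trans_lt hE3x)).le
  have hd0 : ‖e x‖ ≤ δ := by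
    rw [← norm_iteratedFDeriv_zero (𝕜 := ℝ)]; exact hdevk 0 (by norm_num)
  have hd1 : ‖fderiv ℝ e x‖ ≤ δ := by
    rw [(norm_fderiv_eq_norm_iteratedFDeriv e x).1]; exact hdevk 1 (by norm_num)
  have hd2 : ‖fderiv ℝ (fderiv ℝ e) x‖ ≤ δ := by
    rw [(norm_fderiv_eq_norm_iteratedFDeriv e x).2]; exact hdevk 2 (by norm_num)
  have hd3 : ‖fderiv ℝ (fderiv ℝ (fderiv ℝ e)) x‖ ≤ δ := by
    rw [norm_fderiv_fderiv_fderiv_eq_norm_iteratedFDeriv e x]; exact hdevk 3 le_rfl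
  -- the zoom `ψ(w) = x + c w`, `c = 1/l`
  have hl0 : 0 < l := one_pos.trans_le hl
  obtain ⟨c, hc0, hc1, hcl⟩ : ∃ c : ℝ, 0 < c ∧ c ≤ 1 ∧ c * l = 1 :=
    ⟨l⁻¹, inv_pos.2 hl0, inv_le_one_of_one_le₀ hl, inv_mul_cancel₀ hl0.ne'⟩
  have hcne : c ≠ 0 := hc0.ne'
  have hcn : ‖c‖ = c := by rw [Real.norm_eq_abs, abs_of_pos hc0]
  have hc2 : c ^ 2 * l ^ 2 = 1 := by rw [← mul_pow, hcl, one_pow]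
  have hc3 : c ^ 3 * l ^ 3 = 1 := by rw [← mul_pow, hcl, one_pow]
  have hc21 : c ^ 2 ≤ 1 := pow_le_one₀ hc0.le hc1
  have hc31 : c ^ 3 ≤ 1 := pow_le_one₀ hc0.le hc1
  have h0A : x + c • (0 : E4) ∈ A := by simpa using hxA
  -- the zoomed fields (terms as produced by `isMetricOn_comp_zoom`)
  have hGc := isMetricOn_comp_zoom hG x c
  have hG'c := isMetricOn_comp_zoom hG' x c
  have h0 : (0 : E4) ∈ (fun w : E4 ↦ x + c • w) ⁻¹' A := h0A
  -- the zoomed lab field is Ricci-flat near `0`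
  have hRic0 : ricAt (fun w : E4 ↦ (fun w ↦ e w + g₀ w) (x + c • w)) =ᶠ[𝓝 0] fun _ ↦ 0 := by
    filter_upwards [hGc.isOpen.mem_nhds h0] with w hw
    rw [ricAt_comp_zoom_eq hG hcne hw, (hfacts _ hw).2.2.2.2, smul_zero]
  have hRc : ricAt (fun w : E4 ↦ (fun w ↦ e w + g₀ w) (x + c • w)) 0 = 0 := hRic0.eq_of_nhds
  have hDRc : fderiv ℝ (ricAt (fun w : E4 ↦ (fun w ↦ e w + g₀ w) (x + c • w))) 0 = 0 := by
    rw [hRic0.fderiv_eq]; exact fderiv_const_apply 0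
  -- the zoomed ansatz
  have hRc' : ricAt (fun w : E4 ↦ g₀ (x + c • w)) 0 = (c ^ 2) • ricAt g₀ x := by
    rw [ricAt_comp_zoom_eq hG' hcne h0A]; simp
  have hDRc' : fderiv ℝ (ricAt (fun w : E4 ↦ g₀ (x + c • w))) 0 = (c ^ 3) • fderiv ℝ (ricAt g₀) x :=
    fderiv_ricAt_comp_zoom hG' hxA hcne
  -- jets of the zoomed fields at `0`
  have hJ := jets_comp_zoom (c := c) hG'.contDiffOn hAo hxA
  have hJ3 := fderiv_fderiv_fderiv_comp_zoom (c := c) hG'.contDiffOn hAo hxA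
  have hZ := jets_comp_zoom (c := c) hG.contDiffOn hAo hxA
  have hZ3 := fderiv_fderiv_fderiv_comp_zoom (c := c) hG.contDiffOn hAo hxA
  -- the hypotheses of the jet comparison lemmas (scalar bounds)
  have hn1 : ‖fderiv ℝ (fun w : E4 ↦ g₀ (x + c • w)) 0‖ ≤ 1 := by
    rw [hJ.2.1, norm_smul, hcn, ← hcl]; exact mul_le_mul_of_nonneg_left hD1 hc0.le
  have hn2 : ‖fderiv ℝ (fderiv ℝ (fun w : E4 ↦ g₀ (x + c • w))) 0‖ ≤ 1 := by
    rw [hJ.2.2, norm_smul, norm_pow, hcn, ← hc2]; exact mul_le_mul_of_nonneg_left hD2 (by positivity)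
  have hd0' : ‖(fun w : E4 ↦ (fun w ↦ e w + g₀ w) (x + c • w)) 0 - (fun w : E4 ↦ g₀ (x + c • w)) 0‖ ≤ δ := by
    simp only [smul_zero, add_zero, add_sub_cancel_right]; exact hd0
  have hd1' : ‖fderiv ℝ (fun w : E4 ↦ (fun w ↦ e w + g₀ w) (x + c • w)) 0 -
      fderiv ℝ (fun w : E4 ↦ g₀ (x + c • w)) 0‖ ≤ δ := by
    rw [hZ.2.1, hJ.2.1, hS.1, smul_add, add_sub_cancel_right, norm_smul, hcn]
    calc c * ‖fderiv ℝ e x‖ ≤ 1 * δ := mul_le_mul hc1 hd1 (norm_nonneg _) zero_le_one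
      _ = δ := one_mul δ
  have hd2' : ‖fderiv ℝ (fderiv ℝ (fun w : E4 ↦ (fun w ↦ e w + g₀ w) (x + c • w))) 0 -
      fderiv ℝ (fderiv ℝ (fun w : E4 ↦ g₀ (x + c • w))) 0‖ ≤ δ := by
    rw [hZ.2.2, hJ.2.2, hS.2.1, smul_add, add_sub_cancel_right, norm_smul, norm_pow, hcn]
    calc c ^ 2 * ‖fderiv ℝ (fderiv ℝ e) x‖ ≤ 1 * δ := mul_le_mul hc21 hd2 (norm_nonneg _) zero_le_one
      _ = δ := one_mul δ
  have hd3' := congrArg₂ (fun A B ↦ ‖A - B‖) hZ3 hJ3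
  rw [hS.2.2, smul_add, add_sub_cancel_right, norm_smul, norm_pow, hcn] at hd3'
  replace hd3' := hd3'.trans_le (show c ^ 3 * ‖fderiv ℝ (fderiv ℝ (fderiv ℝ e)) x‖ ≤ δ from
    calc c ^ 3 * ‖fderiv ℝ (fderiv ℝ (fderiv ℝ e)) x‖ ≤ 1 * δ :=
        mul_le_mul hc31 hd3 (norm_nonneg _) zero_le_one
      _ = δ := one_mul δ)
  have hval : (fun w : E4 ↦ g₀ (x + c • w)) 0 = g₀ x := by simp only [smul_zero, add_zero]
  have hKA : (fun w : E4 ↦ g₀ (x + c • w)) 0 ∈ KA := by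
    rw [hval]
    refine ⟨hxα, fun v ↦ ?_⟩
    have hm4 : m / 4 ≤ m / 2 := by linarith only [hm0]
    exact (mul_le_mul_of_nonneg_right hm4 (norm_nonneg v)).trans (hxc v)
  have hb1 : fderiv ℝ (fun w : E4 ↦ g₀ (x + c • w)) 0 ∈
      closedBall (0 : E4 →L[ℝ] E4 →L[ℝ] E4 →L[ℝ] ℝ) 1 := mem_closedBall_zero_iff.2 hn1
  have hb2 : fderiv ℝ (fderiv ℝ (fun w : E4 ↦ g₀ (x + c • w))) 0 ∈
      closedBall (0 : E4 →L[ℝ] E4 →L[ℝ] E4 →L[ℝ] E4 →L[ℝ] ℝ) 1 := mem_closedBall_zero_iff.2 hn2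
  have hK' : (((0 : E4), (fun w : E4 ↦ g₀ (x + c • w)) 0, fderiv ℝ (fun w : E4 ↦ g₀ (x + c • w)) 0,
      fderiv ℝ (fderiv ℝ (fun w : E4 ↦ g₀ (x + c • w))) 0) : Jet) ∈ Kj :=
    Set.mk_mem_prod (Set.mem_singleton _) (Set.mk_mem_prod hKA (Set.mk_mem_prod hb1 hb2))
  have hδr : δ ≤ min r₁ r₂ := min_le_left _ _
  have hLip₀' : ∀ j' ∈ Kj, ∀ j : Jet, ‖j - j'‖ ≤ min r₁ r₂ →
      ‖ricciJet (E := E4) j - ricciJet (E := E4) j'‖ ≤ L₀ * ‖j - j'‖ :=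
    fun j' hj' j hj ↦ (hLip₀ j' hj' j (hj.trans (min_le_left _ _))).1
  have hLip₁' : ∀ j' ∈ Kj, ∀ j : Jet, ‖j - j'‖ ≤ min r₁ r₂ →
      ‖fderiv ℝ (ricciJet (E := E4)) j - fderiv ℝ (ricciJet (E := E4)) j'‖ ≤ L₁ * ‖j - j'‖ ∧
        ‖fderiv ℝ (ricciJet (E := E4)) j‖ ≤ B₁ :=
    fun j' hj' j hj ↦ hLip₁ j' hj' j (hj.trans (min_le_right _ _))
  -- `C²`
  have key2 := norm_ricAt_le_of_jets hGc hG'c h0 hRc hL₀ hLip₀' hK' hδ0.le hδr hd0' hd1' hd2'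
  rw [hRc', norm_smul, norm_pow, hcn] at key2
  have hL₀δ : L₀ * δ ≤ ε := by nlinarith only [hδε, hδ0, hL₀, hL₁, hB₁]
  have key2' : c ^ 2 * ‖ricAt g₀ x‖ ≤ ε := key2.trans hL₀δ
  have hC2 : ‖ricAt g₀ x‖ ≤ ε * l ^ 2 := by
    have h' := mul_le_mul_of_nonneg_right key2' (by positivity : (0 : ℝ) ≤ l ^ 2)
    calc ‖ricAt g₀ x‖ = c ^ 2 * ‖ricAt g₀ x‖ * l ^ 2 := by
          rw [mul_comm (c ^ 2), mul_assoc, hc2, mul_one]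
      _ ≤ ε * l ^ 2 := h'
  refine ⟨hC2, fun hD3 ↦ ?_⟩
  -- `C³`
  have hn3 := congrArg (fun A ↦ ‖A‖) hJ3
  rw [norm_smul, norm_pow, hcn] at hn3
  replace hn3 := hn3.trans_le (show c ^ 3 * ‖fderiv ℝ (fderiv ℝ (fderiv ℝ g₀)) x‖ ≤ 1 by
    rw [← hc3]; exact mul_le_mul_of_nonneg_left hD3 (by positivity))
  have key3 := norm_fderiv_ricAt_le_of_jets hGc hG'c h0 hDRc hL₁ hLip₁' hK' hδ0.le hδr hd0' hd1'
    hd2' hd3' hn1 hn2 hn3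
  rw [hDRc', norm_smul, norm_pow, hcn] at key3
  have hL₁δ : (L₁ + B₁) * δ ≤ ε := by nlinarith only [hδε, hδ0, hL₀, hL₁, hB₁]
  have key3' : c ^ 3 * ‖fderiv ℝ (ricAt g₀) x‖ ≤ ε := key3.trans hL₁δ
  have h' := mul_le_mul_of_nonneg_right key3' (by positivity : (0 : ℝ) ≤ l ^ 3)
  calc ‖fderiv ℝ (ricAt g₀) x‖ = c ^ 3 * ‖fderiv ℝ (ricAt g₀) x‖ * l ^ 3 := by
        rw [mul_comm (c ^ 3), mul_assoc, hc3, mul_one]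
    _ ≤ ε * l ^ 3 := h'

/-! ### Reduction of the slaving stub to RELATIVE-RICCI SLAVING -/

/-- **FROZEN-VACUUM SLAVING reduces to RELATIVE-RICCI SLAVING.** If, for all painted moduli as in
the crux (subextremal parameters, `r₋ < rin < r₊`, Lorentz factors `≤ γ`, smooth motions,
separating centres), jet-relative `C²`/`C³` Ricci-smallness of the explicit frozen ansatz `g₀` on
all late hole-following tubes (the conclusion of `exists_relRicci_of_frozenVacuum`) forces
`SLAVED³`, then FROZEN-VACUUM SLAVING (the hypothesis of `slaved3_of_frozenVacuumSlaving`,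
`…StubSlaving12Reduction`) holds. [folklore] -/
theorem frozenVacuumSlaving_of_relRicciSlaving
    (hRRS : ∀ (N : ℕ) (M a rin : Fin N → ℝ) (Λ : Fin N → ℝ → lorentzGroup) (ξ : Fin N → ℝ → E3) (γ : ℝ), (∀ i, Kerr.IsSubextremal (M i) (a i) ∧ Kerr.rMinus (M i) (a i) < rin i ∧ rin i < Kerr.rPlus (M i) (a i)) →
      (∀ i t, |((Λ i t : E4 ≃L[ℝ] E4) (E4.basisVector 0)) 0| ≤ γ) →
      (∀ i, ContDiff ℝ ((⊤ : ℕ∞) : WithTop ℕ∞) (ξ i) ∧ ContDiff ℝ ((⊤ : ℕ∞) : WithTop ℕ∞) (fun t ↦ ((Λ i t : E4 ≃L[ℝ] E4) : E4 →L[ℝ] E4))) →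
      (∀ i j, i ≠ j → Tendsto (fun t ↦ ‖ξ i t - ξ j t‖) atTop atTop) →
      (∀ (i : Fin N) (R r₀ : ℝ), rin i ≤ r₀ → ∀ ε : ℝ, 0 < ε → ∃ T : ℝ, ∀ x : E4, T < x 0 → ‖E4.spatial x - ξ i (x 0)‖ < R → r₀ < Kerr.radius (a i) (poincareInv (Λ i (x 0)) (E4.ofTimeSpace (x 0) (ξ i (x 0))) x) → ∀ l : ℝ, 1 ≤ l → ‖fderiv ℝ (fun z : E4 ↦ Minkowski.bilin + ∑ i, (boostedKerrBilin (Λ i (z 0)) (E4.ofTimeSpace (z 0) (ξ i (z 0))) (M i) (a i) z - Minkowski.bilin)) x‖ ≤ l → ‖fderiv ℝ (fderiv ℝ (fun z : E4 ↦ Minkowski.bilin + ∑ i, (boostedKerrBilin (Λ i (z 0)) (E4.ofTimeSpace (z 0) (ξ i (z 0))) (M i) (a i) z - Minkowski.bilin))) x‖ ≤ l ^ 2 → ‖MetricCoord.ricAt (fun z : E4 ↦ Minkowski.bilin + ∑ i, (boostedKerrBilin (Λ i (z 0)) (E4.ofTimeSpace (z 0) (ξ i (z 0))) (M i) (a i)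 z - Minkowski.bilin)) x‖ ≤ ε * l ^ 2 ∧ (‖fderiv ℝ (fderiv ℝ (fderiv ℝ (fun z : E4 ↦ Minkowski.bilin + ∑ i, (boostedKerrBilin (Λ i (z 0)) (E4.ofTimeSpace (z 0) (ξ i (z 0))) (M i) (a i) z - Minkowski.bilin)))) x‖ ≤ l ^ 3 → ‖fderiv ℝ (MetricCoord.ricAt (fun z : E4 ↦ Minkowski.bilin + ∑ i, (boostedKerrBilin (Λ i (z 0)) (E4.ofTimeSpace (z 0) (ξ i (z 0))) (M i) (a i) z - Minkowski.bilin))) x‖ ≤ ε * l ^ 3)) →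
      (∀ i : Fin N, (∀ m : ℕ, 1 ≤ m → m ≤ 3 → Tendsto (fun t ↦ iteratedDeriv m (fun s ↦ (((Λ i s : lorentzGroup) : E4 ≃L[ℝ] E4) (E4.basisVector 0))) t) atTop (𝓝 0)) ∧ (∀ m : ℕ, m ≤ 2 → Tendsto (fun t ↦ iteratedDeriv m (fun s ↦ deriv (ξ i) s - (((((Λ i s : lorentzGroup) : E4 ≃L[ℝ] E4) (E4.basisVector 0)) 0)⁻¹ • E4.spatial (((Λ i s : lorentzGroup) : E4 ≃L[ℝ] E4) (E4.basisVector 0)))) t) atTop (𝓝 0)) ∧ (a i ≠ 0 → ∀ m : ℕ, 1 ≤ m → m ≤ 3 → Tendsto (fun t ↦ iteratedDeriv m (fun s ↦ (((Λ i s : lorentzGroup) : E4 ≃L[ℝ] E4) (E4.basisVector 3))) t) atTop (𝓝 0)))) :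
    ∀ (N : ℕ) (M a rin : Fin N → ℝ) (Λ : Fin N → ℝ → lorentzGroup) (ξ : Fin N → ℝ → E3) (γ : ℝ) (e : E4 → E4 →L[ℝ] E4 →L[ℝ] ℝ), (∀ i, Kerr.IsSubextremal (M i) (a i) ∧ Kerr.rMinus (M i) (a i) < rin i ∧ rin i < Kerr.rPlus (M i) (a i)) →
      (∀ i t, |((Λ i t : E4 ≃L[ℝ] E4) (E4.basisVector 0)) 0| ≤ γ) →
      (∀ i, ContDiff ℝ ((⊤ : ℕ∞) : WithTop ℕ∞) (ξ i) ∧ ContDiff ℝ ((⊤ : ℕ∞) : WithTop ℕ∞) (fun t ↦ ((Λ i t : E4 ≃L[ℝ] E4) : E4 →L[ℝ] E4))) →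
      (∀ i j, i ≠ j → Tendsto (fun t ↦ ‖ξ i t - ξ j t‖) atTop atTop) →
      (∀ (i : Fin N) (R r₀ : ℝ), rin i ≤ r₀ → ∃ T : ℝ, MetricCoord.IsMetricOn (fun z : E4 ↦ e z + (Minkowski.bilin + ∑ i, (boostedKerrBilin (Λ i (z 0)) (E4.ofTimeSpace (z 0) (ξ i (z 0))) (M i) (a i) z - Minkowski.bilin))) {x : E4 | T < x 0 ∧ ‖E4.spatial x - ξ i (x 0)‖ < R ∧ r₀ < Kerr.radius (a i) (poincareInv (Λ i (x 0)) (E4.ofTimeSpace (x 0) (ξ i (x 0))) x)} ∧ ∀ x : E4, T < x 0 → ‖E4.spatial x - ξ i (x 0)‖ < R → r₀ < Kerr.radius (a i) (poincareInv (Λ i (x 0)) (E4.ofTimeSpace (x 0) (ξ i (x 0))) x) → (∀ j, rin j < Kerr.radius (a j) (poincareInv (Λ j (x 0)) (E4.ofTimeSpace (x 0) (ξ j (x 0))) x)) ∧ MetricCoord.ricAt (fun z : E4 ↦ e z + (Minkowski.bilin + ∑ i, (boostedKerrBilin (Λ i (z 0)) (E4.ofTimeSpace (z 0) (ξ i (z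 0))) (M i) (a i) z - Minkowski.bilin))) x = 0) →
      Tendsto (fun t : ℝ ↦ supCkENorm {x : E4 | x 0 = t ∧ ∀ j, rin j < Kerr.radius (a j) (poincareInv (Λ j (x 0)) (E4.ofTimeSpace (x 0) (ξ j (x 0))) x)} 3 e) atTop (𝓝 0) →
      (∀ i : Fin N, (∀ m : ℕ, 1 ≤ m → m ≤ 3 → Tendsto (fun t ↦ iteratedDeriv m (fun s ↦ (((Λ i s : lorentzGroup) : E4 ≃L[ℝ] E4) (E4.basisVector 0))) t) atTop (𝓝 0)) ∧ (∀ m : ℕ, m ≤ 2 → Tendsto (fun t ↦ iteratedDeriv m (fun s ↦ deriv (ξ i) s - (((((Λ i s : lorentzGroup) : E4 ≃L[ℝ] E4) (E4.basisVector 0)) 0)⁻¹ • E4.spatial (((Λ i s : lorentzGroup) : E4 ≃L[ℝ] E4) (E4.basisVector 0)))) t) atTop (𝓝 0)) ∧ (a i ≠ 0 → ∀ m : ℕ, 1 ≤ m → m ≤ 3 → Tendsto (fun t ↦ iteratedDeriv m (fun s ↦ (((Λ i s : lorentzGroup) : E4 ≃L[ℝ] E4) (E4.basisVector 3))) t) atTop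 (𝓝 0))) :=
  fun N M a rin Λ ξ γ _ h1 hγ hsm hsep hV hS ↦ hRRS N M a rin Λ ξ γ h1 hγ hsm hsep
    fun i R r₀ hr₀ _ hε ↦ exists_relRicci_of_frozenVacuum h1 hγ hsm hsep hV hS i R r₀ hr₀ hε

/-- **The registered stub `stub_slaving` reduces to RELATIVE-RICCI SLAVING** (a statement about
the explicit ansatz `g₀` alone): `stub_slaving_of_frozenVacuumSlaving ∘
frozenVacuumSlaving_of_relRicciSlaving`. [folklore] -/
theorem stub_slaving_of_relRicciSlaving
    (hRRS : ∀ (N : ℕ) (M a rin : Fin N → ℝ) (Λ : Fin N → ℝ → lorentzGroup) (ξ : Fin N → ℝ → E3) (γ : ℝ), (∀ i, Kerr.IsSubextremal (M i) (a i) ∧ Kerr.rMinus (M i) (a i) < rin i ∧ rin i < Kerr.rPlus (M i) (a i)) →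
      (∀ i t, |((Λ i t : E4 ≃L[ℝ] E4) (E4.basisVector 0)) 0| ≤ γ) →
      (∀ i, ContDiff ℝ ((⊤ : ℕ∞) : WithTop ℕ∞) (ξ i) ∧ ContDiff ℝ ((⊤ : ℕ∞) : WithTop ℕ∞) (fun t ↦ ((Λ i t : E4 ≃L[ℝ] E4) : E4 →L[ℝ] E4))) →
      (∀ i j, i ≠ j → Tendsto (fun t ↦ ‖ξ i t - ξ j t‖) atTop atTop) →
      (∀ (i : Fin N) (R r₀ : ℝ), rin i ≤ r₀ → ∀ ε : ℝ, 0 < ε → ∃ T : ℝ, ∀ x : E4, T < x 0 → ‖E4.spatial x - ξ i (x 0)‖ < R → r₀ < Kerr.radius (a i) (poincareInv (Λ i (x 0)) (E4.ofTimeSpace (x 0) (ξ i (x 0))) x) → ∀ l : ℝ, 1 ≤ l → ‖fderiv ℝ (fun z : E4 ↦ Minkowski.bilin + ∑ i, (boostedKerrBilin (Λ i (z 0)) (E4.ofTimeSpace (z 0) (ξ i (z 0))) (M i) (a i) z - Minkowski.bilin)) x‖ ≤ l → ‖fderiv ℝ (fderiv ℝ (fun z : E4 ↦ Minkowski.bilin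 + ∑ i, (boostedKerrBilin (Λ i (z 0)) (E4.ofTimeSpace (z 0) (ξ i (z 0))) (M i) (a i) z - Minkowski.bilin))) x‖ ≤ l ^ 2 → ‖MetricCoord.ricAt (fun z : E4 ↦ Minkowski.bilin + ∑ i, (boostedKerrBilin (Λ i (z 0)) (E4.ofTimeSpace (z 0) (ξ i (z 0))) (M i) (a i) z - Minkowski.bilin)) x‖ ≤ ε * l ^ 2 ∧ (‖fderiv ℝ (fderiv ℝ (fderiv ℝ (fun z : E4 ↦ Minkowski.bilin + ∑ i, (boostedKerrBilin (Λ i (z 0)) (E4.ofTimeSpace (z 0) (ξ i (z 0))) (M i) (a i) z - Minkowski.bilin)))) x‖ ≤ l ^ 3 → ‖fderiv ℝ (MetricCoord.ricAt (fun z : E4 ↦ Minkowski.bilin + ∑ i, (boostedKerrBilin (Λ i (z 0)) (E4.ofTimeSpace (z 0) (ξ i (z 0))) (M i) (a i) z - Minkowski.bilin))) x‖ ≤ ε * l ^ 3)) →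
      (∀ i : Fin N, (∀ m : ℕ, 1 ≤ m → m ≤ 3 → Tendsto (fun t ↦ iteratedDeriv m (fun s ↦ (((Λ i s : lorentzGroup) : E4 ≃L[ℝ] E4) (E4.basisVector 0))) t) atTop (𝓝 0)) ∧ (∀ m : ℕ, m ≤ 2 → Tendsto (fun t ↦ iteratedDeriv m (fun s ↦ deriv (ξ i) s - (((((Λ i s : lorentzGroup) : E4 ≃L[ℝ] E4) (E4.basisVector 0)) 0)⁻¹ • E4.spatial (((Λ i s : lorentzGroup) : E4 ≃L[ℝ] E4) (E4.basisVector 0)))) t) atTop (𝓝 0)) ∧ (a i ≠ 0 → ∀ m : ℕ, 1 ≤ m → m ≤ 3 → Tendsto (fun t ↦ iteratedDeriv m (fun s ↦ (((Λ i s : lorentzGroup) : E4 ≃L[ℝ] E4) (E4.basisVector 3))) t) atTop (𝓝 0)))) :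
    ∀ (X : Type) [TopologicalSpace X] [ChartedSpace E3 X] [IsManifold (𝓡 3) ((⊤ : ℕ∞) : WithTop ℕ∞) X] [T2Space X] [SecondCountableTopology X] [ConnectedSpace X], ∀ D ∈ admissibleVacuumData X, ∀ 𝒟 : VacuumCauchyDevelopment D, 𝒟.IsMaximal → ∀ (N : ℕ) (M a rin : Fin N → ℝ) (Λ : Fin N → ℝ → lorentzGroup) (ξ : Fin N → ℝ → E3) (γ κ τ₀ : ℝ) (U : Opens E4) (Φ : U → 𝒟.carrier) (O : Set 𝒟.carrier), ((∀ i, Kerr.IsSubextremal (M i) (a i) ∧ Kerr.rMinus (M i) (a i) < rin i ∧ rin i < Kerr.rPlus (M i) (a i)) ∧ (∀ i t, |((Λ i t : E4 ≃L[ℝ] E4) (E4.basisVector 0)) 0| ≤ γ) ∧ (∀ i, ContDiff ℝ ((⊤ : ℕ∞) : WithTop ℕ∞) (ξ i) ∧ ContDiff ℝ ((⊤ : ℕ∞) : WithTop ℕ∞) (fun t ↦ ((Λ i t : E4 ≃L[ℝ] E4) : E4 →L[ℝ] E4))) ∧ (∀ i j, i ≠ j → Tendsto (fun t ↦ ‖ξ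 i t - ξ j t‖) atTop atTop) ∧ (0 < κ ∧ κ < 1 ∧ ∀ i, ∀ᶠ t in atTop, ‖ξ i t‖ ≤ κ ^ 2 * t) ∧ ({x : E4 | τ₀ < x 0 ∧ ∀ i, rin i < Kerr.radius (a i) (poincareInv (Λ i (x 0)) (E4.ofTimeSpace (x 0) (ξ i (x 0))) x)} ⊆ (U : Set E4)) ∧ let B : ModelBackground := ⟨U, fun x ↦ Minkowski.bilin + ∑ i, (boostedKerrBilin (Λ i (x 0)) (E4.ofTimeSpace (x 0) (ξ i (x 0))) (M i) (a i) x - Minkowski.bilin), fun x ↦ x 0, E4.spatialNorm⟩; ContMDiff 𝓘(ℝ, E4) (𝓡 4) ((⊤ : ℕ∞) : WithTop ℕ∞) Φ ∧ Topology.IsOpenEmbedding ((B.lateRegion τ₀).restrict Φ) ∧ Φ '' {x : U | τ₀ < x.1 0 ∧ ∀ i, Kerr.rPlus (M i) (a i) < Kerr.radius (a i) (poincareInv (Λ i (x.1 0)) (E4.ofTimeSpace (x.1 0) (ξ i (x.1 0))) x.1)} ⊆ O ∧ Tendsto (fun t ↦ 𝒟.toSpacetime.deviationCk B Φ 3 t)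 atTop (𝓝 0) ∧ Tendsto (fun t : ℝ ↦ ⨆ x ∈ {x : U | x.1 0 = t ∧ E4.spatialNorm x.1 ≤ κ * t}, ⨆ (m : ℕ) (_ : m ≤ 3), ENNReal.ofReal (1 + √(√((⨅ i, ‖E4.spatial x.1 - ξ i t‖) ^ 7))) * ‖iteratedFDeriv ℝ m (𝒟.toSpacetime.deviationExtend B Φ) x.1‖ₑ) atTop (𝓝 0) ∧ O = Summit.FinalStateConjecture.exteriorOf 𝒟.toCauchyDevelopment (Φ '' {x : U | τ₀ < x.1 0 ∧ ∀ i, Kerr.rPlus (M i) (a i) < Kerr.radius (a i) (poincareInv (Λ i (x.1 0)) (E4.ofTimeSpace (x.1 0) (ξ i (x.1 0))) x.1)}) ∧ ∀ t₁ : ℝ, τ₀ < t₁ → O \ Φ '' {x : U | t₁ < x.1 0 ∧ ∀ i, Kerr.rPlus (M i) (a i) < Kerr.radius (a i) (poincareInv (Λ i (x.1 0)) (E4.ofTimeSpace (x.1 0) (ξ i (x.1 0))) x.1)} ⊆ 𝒟.metric.causalPast 𝒟.timeOrientation (Φ '' {x : U | x.1 0 = t₁ ∧ ∀ i, Kerr.rPlus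 (M i) (a i) < Kerr.radius (a i) (poincareInv (Λ i (x.1 0)) (E4.ofTimeSpace (x.1 0) (ξ i (x.1 0))) x.1)})) →
    (∀ i : Fin N, (∀ m : ℕ, 1 ≤ m → m ≤ 3 → Tendsto (fun t ↦ iteratedDeriv m (fun s ↦ (((Λ i s : lorentzGroup) : E4 ≃L[ℝ] E4) (E4.basisVector 0))) t) atTop (𝓝 0)) ∧ (∀ m : ℕ, m ≤ 2 → Tendsto (fun t ↦ iteratedDeriv m (fun s ↦ deriv (ξ i) s - (((((Λ i s : lorentzGroup) : E4 ≃L[ℝ] E4) (E4.basisVector 0)) 0)⁻¹ • E4.spatial (((Λ i s : lorentzGroup) : E4 ≃L[ℝ] E4) (E4.basisVector 0)))) t) atTop (𝓝 0)) ∧ (a i ≠ 0 → ∀ m : ℕ, 1 ≤ m → m ≤ 3 → Tendsto (fun t ↦ iteratedDeriv m (fun s ↦ (((Λ i s : lorentzGroup) : E4 ≃L[ℝ] E4) (E4.basisVector 3))) t) atTop (𝓝 0))) ∧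
    ((∀ i : Fin N, Continuous (fun t ↦ (((((Λ i t : lorentzGroup) : E4 ≃L[ℝ] E4) (E4.basisVector 0)) 0)⁻¹ • E4.spatial (((Λ i t : lorentzGroup) : E4 ≃L[ℝ] E4) (E4.basisVector 0))))) ∧ (∃ k : ℝ, 0 ≤ k ∧ k < 1 ∧ ∀ (i : Fin N) (t : ℝ), ‖(((((Λ i t : lorentzGroup) : E4 ≃L[ℝ] E4) (E4.basisVector 0)) 0)⁻¹ • E4.spatial (((Λ i t : lorentzGroup) : E4 ≃L[ℝ] E4) (E4.basisVector 0)))‖ ≤ k)) :=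
  stub_slaving_of_frozenVacuumSlaving (frozenVacuumSlaving_of_relRicciSlaving hRRS)

/-- **Registered one-line carrier form** (`slaving_relRicci_of_frozenVacuum_slaving12`) of
`exists_relRicci_of_frozenVacuum`. [folklore] -/
theorem slaving_relRicci_of_frozenVacuum_slaving12 : open Literature.Geometry.Lorentzian Filter Topology in ∀ {N : ℕ} {M a rin : Fin N → ℝ} {Λ : Fin N → ℝ → lorentzGroup} {ξ : Fin N → ℝ → E3} {γ : ℝ} {e : E4 → E4 →L[ℝ] E4 →L[ℝ] ℝ}, (∀ i, Kerr.IsSubextremal (M i) (a i) ∧ Kerr.rMinus (M i) (a i) < rin i ∧ rin i < Kerr.rPlus (M i) (a i)) → (∀ i t, |((Λ i t : E4 ≃L[ℝ] E4) (E4.basisVector 0)) 0| ≤ γ) → (∀ i, ContDiff ℝ ((⊤ : ℕ∞) : WithTop ℕ∞) (ξ i) ∧ ContDiff ℝ ((⊤ : ℕ∞) : WithTop ℕ∞) (fun t ↦ ((Λ i t : E4 ≃L[ℝ] E4) : E4 →L[ℝ] E4))) → (∀ i j, i ≠ j → Tendsto (fun t ↦ ‖ξ i t - ξ j t‖) atTop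 atTop) → (∀ (i : Fin N) (R r₀ : ℝ), rin i ≤ r₀ → ∃ T : ℝ, MetricCoord.IsMetricOn (fun z : E4 ↦ e z + (Minkowski.bilin + ∑ i, (boostedKerrBilin (Λ i (z 0)) (E4.ofTimeSpace (z 0) (ξ i (z 0))) (M i) (a i) z - Minkowski.bilin))) {x : E4 | T < x 0 ∧ ‖E4.spatial x - ξ i (x 0)‖ < R ∧ r₀ < Kerr.radius (a i) (poincareInv (Λ i (x 0)) (E4.ofTimeSpace (x 0) (ξ i (x 0))) x)} ∧ ∀ x : E4, T < x 0 → ‖E4.spatial x - ξ i (x 0)‖ < R → r₀ < Kerr.radius (a i) (poincareInv (Λ i (x 0)) (E4.ofTimeSpace (x 0) (ξ i (x 0))) x) → (∀ j, rin j < Kerr.radius (a j) (poincareInv (Λ j (x 0)) (E4.ofTimeSpace (x 0) (ξ j (x 0))) x)) ∧ MetricCoord.ricAt (fun z : E4 ↦ e z + (Minkowski.bilin + ∑ i, (boostedKerrBilin (Λ i (z 0)) (E4.ofTimeSpace (z 0) (ξ i (z 0))) (M i) (a i) z - Minkowski.bilin))) x = 0) → Tendsto (fun t : ℝ ↦ supCkENorm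 {x : E4 | x 0 = t ∧ ∀ j, rin j < Kerr.radius (a j) (poincareInv (Λ j (x 0)) (E4.ofTimeSpace (x 0) (ξ j (x 0))) x)} 3 e) atTop (𝓝 0) → ∀ (i : Fin N) (R r₀ : ℝ), rin i ≤ r₀ → ∀ {ε : ℝ}, 0 < ε → ∃ T : ℝ, ∀ x : E4, T < x 0 → ‖E4.spatial x - ξ i (x 0)‖ < R → r₀ < Kerr.radius (a i) (poincareInv (Λ i (x 0)) (E4.ofTimeSpace (x 0) (ξ i (x 0))) x) → ∀ l : ℝ, 1 ≤ l → ‖fderiv ℝ (fun z : E4 ↦ Minkowski.bilin + ∑ i, (boostedKerrBilin (Λ i (z 0)) (E4.ofTimeSpace (z 0) (ξ i (z 0))) (M i) (a i) z - Minkowski.bilin)) x‖ ≤ l → ‖fderiv ℝ (fderiv ℝ (fun z : E4 ↦ Minkowski.bilin + ∑ i, (boostedKerrBilin (Λ i (z 0)) (E4.ofTimeSpace (z 0) (ξ i (z 0))) (M i) (a i) z - Minkowski.bilin))) x‖ ≤ l ^ 2 → ‖MetricCoord.ricAt (fun z : E4 ↦ Minkowski.bilin + ∑ i, (boostedKerrBilin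 (Λ i (z 0)) (E4.ofTimeSpace (z 0) (ξ i (z 0))) (M i) (a i) z - Minkowski.bilin)) x‖ ≤ ε * l ^ 2 ∧ (‖fderiv ℝ (fderiv ℝ (fderiv ℝ (fun z : E4 ↦ Minkowski.bilin + ∑ i, (boostedKerrBilin (Λ i (z 0)) (E4.ofTimeSpace (z 0) (ξ i (z 0))) (M i) (a i) z - Minkowski.bilin)))) x‖ ≤ l ^ 3 → ‖fderiv ℝ (MetricCoord.ricAt (fun z : E4 ↦ Minkowski.bilin + ∑ i, (boostedKerrBilin (Λ i (z 0)) (E4.ofTimeSpace (z 0) (ξ i (z 0))) (M i) (a i) z - Minkowski.bilin))) x‖ ≤ ε * l ^ 3) :=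
  fun h1 hγ hsm hsep hV hS i R r₀ hr₀ _ hε ↦
    exists_relRicci_of_frozenVacuum h1 hγ hsm hsep hV hS i R r₀ hr₀ hε

end Summit.FinalStateConjecture.FinalStateConjecture.Theorems.SublinearIsFree.Slaving

end
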